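import Literature.AlgebraicGeometry.Modules.PullbackStalk
import Mathlib.RingTheory.Flat.FaithfullyFlat.Algebra
import HarnessLib

/-!
# Inverse image along a flat surjective morphism reflects isomorphisms of `𝒪`-modules

For a morphism of schemes `f : X → Y` which is FLAT and SURJECTIVE (e.g. faithfully flat, fpqc
covering; a finite locally free surjective map such as the quotient by a free action of a finite
group), a morphism `φ : N' ⟶ N` of `𝒪_Y`-modules whose inverse image `f^*φ` is an isomorphism is
itself an isomorphism. Proof (Görtz–Wedhorn I (7.8.6) / Remark 7.9, Prop. 14.50 in spirit; EGA
IV₂ 2.2.7): by the stalk formula `(f^*N)_x ≅ 𝒪_{X,x} ⊗_{𝒪_{Y,f x}} N_{f x}`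
(`Literature.AlgebraicGeometry.Modules.stalkPullbackIso`) the stalk map `φ_{f x}` becomes bijective
after the base change `𝒪_{X,x} ⊗_{𝒪_{Y,f x}} –`, which is FAITHFULLY flat (a flat local
homomorphism of local rings; Mathlib `Module.FaithfullyFlat.of_flat_of_isLocalHom`), hence is
bijective (Mathlib `Module.FaithfullyFlat.lTensor_bijective_iff_bijective`); `f` being surjective,
every stalk map of `φ` is bijective, so `φ` is an isomorphism (Mathlib
`TopCat.Presheaf.app_bijective_of_stalkFunctor_map_bijective`).

* `stalkFunctor_map_bijective_of_pullback` — `f^*φ` iso ⇒ `φ_{f x}` bijective (`f` flat);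
* `isIso_of_isIso_pullback_map` — **`f^*φ` iso ⇒ `φ` iso** for `f` flat and surjective;
* `isIso_iff_isIso_pullback_map` — the equivalence.

No quasi-coherence hypothesis is needed. Everything is proved; no named facts.

## References

* U. Görtz, T. Wedhorn, *Algebraic Geometry I*, 2nd ed. (2020), (7.8.6), Remark 7.9, Prop. 14.50
  (faithfully flat morphisms; `f^*` faithful and conservative). [GortzWedhorn2020]
* A. Grothendieck, EGA IV₂ (Publ. Math. IHÉS 24, 1965), Prop. 2.2.7. [folklore]
-/

noncomputable section

-- `TopCat.Presheaf`/`Scheme.Modules` are not reducible (as in Mathlib's `AlgebraicGeometry/Modules`).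
set_option backward.isDefEq.respectTransparency false

open CategoryTheory Limits AlgebraicGeometry TopologicalSpace Opposite

universe u

namespace Literature.AlgebraicGeometry.Modules

variable {X Y : Scheme.{u}} (f : X ⟶ Y)

/-- **`f^*φ` iso ⇒ `φ_{f x}` bijective, for `f` flat.** Under the stalk formula
`(f^*N)_x ≅ 𝒪_{X,x} ⊗_{𝒪_{Y,f x}} N_{f x}` (natural in `N`) the stalk of `f^*φ` at `x` is
`𝒪_{X,x} ⊗ φ_{f x}`; the flat local homomorphism `f_x♯ : 𝒪_{Y,f x} → 𝒪_{X,x}` is faithfully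
flat, so bijectivity descends. [cite: GortzWedhorn2020, (7.8.6) and Remark 7.9] -/
theorem stalkFunctor_map_bijective_of_pullback [Flat f] {N' N : Y.Modules} (φ : N' ⟶ N)
    [IsIso ((Scheme.Modules.pullback f).map φ)] (x : X) :
    Function.Bijective ((stalkFunctor (f x)).map φ) := by
  -- the base-changed stalk map is an isomorphism, by naturality of the stalk formula
  have hnat := (stalkPullbackIso f x).hom.naturality φ
  haveI : IsIso ((Scheme.Modules.pullback f ⋙ stalkFunctor x).map φ) := by
    change IsIso ((stalkFunctor x).map ((Scheme.Modules.pullback f).map φ))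
    infer_instance
  haveI : IsIso ((stalkFunctor (f x) ⋙
      ModuleCat.extendScalars.{u, u, u} (f.stalkMap x).hom).map φ) := by
    have h : (stalkFunctor (f x) ⋙ ModuleCat.extendScalars.{u, u, u} (f.stalkMap x).hom).map φ =
        (stalkPullbackIso f x).inv.app N' ≫ (Scheme.Modules.pullback f ⋙ stalkFunctor x).map φ ≫
          (stalkPullbackIso f x).hom.app N := by
      rw [hnat, Iso.inv_hom_id_app_assoc]
    rw [h]
    infer_instance
  have hbij : Function.Bijective
      ((ModuleCat.extendScalars.{u, u, u} (f.stalkMap x).hom).map ((stalkFunctor (f x)).map φ)) := by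
    change Function.Bijective ((stalkFunctor (f x) ⋙
      ModuleCat.extendScalars.{u, u, u} (f.stalkMap x).hom).map φ)
    exact ConcreteCategory.bijective_of_isIso _
  -- faithful flatness of the flat local homomorphism `𝒪_{Y,f x} → 𝒪_{X,x}`
  algebraize [(f.stalkMap x).hom]
  haveI : Module.FaithfullyFlat (Y.presheaf.stalk (f x)) (X.presheaf.stalk x) :=
    @Module.FaithfullyFlat.of_flat_of_isLocalHom _ _ _ _ _ _ _
      (Flat.stalkMap f x) (f.toLRSHom.prop x)
  -- the base-changed map is `lTensor` of the stalk map
  have hl : ((ModuleCat.extendScalars.{u, u, u} (f.stalkMap x).hom).map ((stalkFunctor (f x)).map φ) :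
        _ → _) = ((stalkFunctor (f x)).map φ).hom.lTensor (X.presheaf.stalk x) := by
    ext t
    induction t using TensorProduct.induction_on with
    | zero => simp
    | tmul s m => rfl
    | add a b ha hb => rw [map_add, map_add, ha, hb]
  rw [hl] at hbij
  exact (Module.FaithfullyFlat.lTensor_bijective_iff_bijective _ _ _).mp hbij

/-- **Inverse image along a flat surjective morphism reflects isomorphisms**: if `f : X → Y` is
flat and surjective and `f^*φ` is an isomorphism of `𝒪_X`-modules, then `φ` is an isomorphism of
`𝒪_Y`-modules (all stalk maps `φ_y = φ_{f x}` are bijective; isomorphisms of sheaves are detected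
on stalks). [cite: GortzWedhorn2020, Prop. 14.50 with (7.8.6)] -/
theorem isIso_of_isIso_pullback_map [Flat f] [Surjective f] {N' N : Y.Modules} (φ : N' ⟶ N)
    [IsIso ((Scheme.Modules.pullback f).map φ)] : IsIso φ := by
  have hst : ∀ y : Y, Function.Bijective ((stalkFunctor y).map φ) := by
    intro y
    obtain ⟨x, rfl⟩ := ‹Surjective f›.surj y
    exact stalkFunctor_map_bijective_of_pullback f φ x
  -- sections are bijective, stalk maps being bijective (sheaves of abelian groups)
  have happ : ∀ U : Y.Opens, Function.Bijective (φ.app U) := by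
    intro U
    have h := TopCat.Presheaf.app_bijective_of_stalkFunctor_map_bijective
      (F := ⟨N'.presheaf, N'.isSheaf⟩) (G := ⟨N.presheaf, N.isSheaf⟩) ⟨φ.mapPresheaf⟩ U
      (fun y _ => hst y)
    exact h
  rw [Scheme.Modules.Hom.isIso_iff_isIso_app]
  intro U
  haveI : IsIso ((forget Ab).map (φ.app U)) := (isIso_iff_bijective _).mpr (happ U)
  exact isIso_of_reflects_iso (φ.app U) (forget Ab)

/-- For `f` flat and surjective, `φ` is an isomorphism iff `f^*φ` is.
[cite: GortzWedhorn2020, Prop. 14.50 with (7.8.6)] -/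
theorem isIso_iff_isIso_pullback_map [Flat f] [Surjective f] {N' N : Y.Modules} (φ : N' ⟶ N) :
    IsIso φ ↔ IsIso ((Scheme.Modules.pullback f).map φ) :=
  ⟨fun _ => inferInstance, fun _ => isIso_of_isIso_pullback_map f φ⟩

end Literature.AlgebraicGeometry.Modules
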